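import Summits.ResolutionOfSingularities.ResolutionOfSingularities.Theorems.DeltaCutStellarHypPersist
import Summits.ResolutionOfSingularities.ResolutionOfSingularities.Theorems.DeltaCutStellarNearPoint

/-!
# StellarCut T12a — «HypFibreData»: the local data of a face at a point — labelled parameters, the monomial as a product of
# parameters, exponent bookkeeping (lens-6, g33; 0-weight tools for the tame guard `DeltaCutStellarHypFibre`)

At a point `y` of an s.n.c. list `Es` (`HasSNC Es`), the divisors through `y` are cut out by DISTINCT members `z (lab K)` of ONE
regular system of parameters `z` of `𝒪_{X,y}` (`exists_isRsopPart_lab`, a total labelling `lab` re-packaging the point clause of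
`HasSNC`).  For a labelled boundary `E` over `Es`:

* `stalkIdeal_monomialIdeal_eq_span_prod` — `𝓜(E)_y = (∏_{(K,a) ∈ E, y ∈ V(K)} z(lab K)^a)`;
* `prod_map_pow_ite_mem_eq` — the factors indexed by a set `T` of divisors regroup as `∏_{K ∈ T} v(K)^{expOf E K}`
  (`expOf E K = Σ_{(K,a) ∈ E} a`), and `sum_expOf_eq_weightOf` — `Σ_{K ∈ T} expOf E K = weightOf E T`;
* `expOf_eq_zero_of_labels` — the contact member `H`, labelled `0`, has exponent `0`;
* Literature's `exists_le_sum_eq` (an exponent vector of total weight `≥ n` dominates one of weight exactly `n`),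
  `weightOf_empty` and `map_dehomogenize` are used BY NAME downstream (not restated here);
* `IsRsopPart.isQuasiRegular'` — a part of a regular system of parameters is a quasi-regular sequence (Matsumura 16.2 (i), from
  Literature's `isQuasiRegular_rsop_comp`), the input format of the near-point order bound `DeltaCutStellarNearPoint`.

Pure bookkeeping; 0 sorry; axioms standard. [folklore] [cite: Matsumura1987, Thm. 16.2 (i)]
[cite: BierstoneGrigorievMilmanWlodarczyk2011, Def. 3.1.1 and §4 Step 2b]
-/

noncomputable section

open CategoryTheory CategoryTheory.Limits AlgebraicGeometry TopologicalSpace IsLocalRing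
open Literature.AlgebraicGeometry.Resolution

namespace Summit.ResolutionOfSingularities.ResolutionOfSingularities.Theorems.DeltaCutClasses

open Summit.ResolutionOfSingularities.ResolutionOfSingularities.Theorems

/-! ### §Exponents — `expOf`, `weightOf` bookkeeping and exponent vectors -/

section Exponents

variable {X : Scheme.{0}}

/-- unfolding `expOf` on a cons. [folklore] -/
theorem expOf_cons [DecidableEq X.IdealSheafData] (p : X.IdealSheafData × ℕ) (E : List (X.IdealSheafData × ℕ))
    (K : X.IdealSheafData) : expOf (p :: E) K = (if p.1 = K then p.2 else 0) + expOf E K := by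
  by_cases h : p.1 = K
  · simp [expOf, weightOf_cons, h]
  · simp [expOf, weightOf_cons, h]

/-- `expOf [] K = 0`. [folklore] -/
@[simp] theorem expOf_nil (K : X.IdealSheafData) : expOf ([] : List (X.IdealSheafData × ℕ)) K = 0 := weightOf_nil _

/-- **`Σ_{K ∈ T} expOf E K = weightOf E T`.** [folklore] -/
theorem sum_expOf_eq_weightOf (E : List (X.IdealSheafData × ℕ)) (T : Finset X.IdealSheafData) :
    ∑ K ∈ T, expOf E K = weightOf E T := by
  classical
  induction T using Finset.induction_on with
  | empty => rw [Finset.sum_empty, weightOf_empty]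
  | insert K T hK ih => rw [Finset.sum_insert hK, weightOf_insert E hK, ih]

/-- the contact member, all of whose entries are labelled `0`, has exponent `0`. [folklore] -/
theorem expOf_eq_zero_of_labels {E : List (X.IdealSheafData × ℕ)} {H : X.IdealSheafData}
    (hlab : ∀ q ∈ E, q.1 = H → q.2 = 0) : expOf E H = 0 := by
  classical
  induction E with
  | nil => exact expOf_nil H
  | cons p E ih =>
    rw [expOf_cons, ih fun q hq => hlab q (List.mem_cons_of_mem _ hq), add_zero]
    by_cases hp : p.1 = H
    · rw [if_pos hp]; exact hlab p List.mem_cons_self hp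
    · rw [if_neg hp]

/-- **Regrouping the `T`-factors of a labelled product by divisor**: for any `v`,
`∏_{(K,a) ∈ E, K ∈ T} v(K)^a = ∏_{K ∈ T} v(K)^{expOf E K}`. [folklore] -/
theorem prod_map_pow_ite_mem_eq {R : Type*} [CommMonoid R] (E : List (X.IdealSheafData × ℕ)) (T : Finset X.IdealSheafData)
    [DecidablePred (· ∈ T)] (v : X.IdealSheafData → R) :
    (E.map fun p => if p.1 ∈ T then v p.1 ^ p.2 else 1).prod = ∏ K ∈ T, v K ^ expOf E K := by
  classical
  induction E with
  | nil => simp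
  | cons p E ih =>
    rw [List.map_cons, List.prod_cons, ih]
    have hsplit : ∏ K ∈ T, v K ^ expOf (p :: E) K = (∏ K ∈ T, v K ^ (if p.1 = K then p.2 else 0)) *
        ∏ K ∈ T, v K ^ expOf E K := by
      rw [← Finset.prod_mul_distrib]
      exact Finset.prod_congr rfl fun K _ => by rw [expOf_cons, pow_add]
    rw [hsplit]
    congr 1
    by_cases hp : p.1 ∈ T
    · rw [if_pos hp, Finset.prod_eq_single_of_mem p.1 hp fun K _ hK => by rw [if_neg (Ne.symm hK), pow_zero],
        if_pos rfl]
    · rw [if_neg hp]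
      exact (Finset.prod_eq_one fun K hK => by rw [if_neg (fun h : p.1 = K => hp (by rw [h]; exact hK)), pow_zero]).symm

end Exponents

/-! ### §Labels — the total labelling of the divisors through a point by members of one regular system of parameters -/

section Labels

variable {X : Scheme.{0}} {Es : List X.IdealSheafData}

/-- **Labelled parameters at a point** (the point clause of `HasSNC`, with a TOTAL labelling function): a regular system of
parameters part `z : Fin d → 𝒪_{X,y}` and `lab : IdealSheafData → Fin d` with `K_y = (z (lab K))` for every member `K ∈ Es`
through `y`, distinct members through `y` getting distinct labels. [cite: BierstoneGrigorievMilmanWlodarczyk2011, Def. 3.1.1] -/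
theorem exists_isRsopPart_lab (hEs : HasSNC Es) {y : X} {K₀ : X.IdealSheafData} (hK₀ : K₀ ∈ Es) (hy₀ : y ∈ K₀.support) :
    ∃ (d : ℕ) (z : Fin d → X.presheaf.stalk y) (lab : X.IdealSheafData → Fin d), IsRsopPart z ∧
      (∀ K ∈ Es, y ∈ K.support → stalkIdeal K y = Ideal.span {z (lab K)}) ∧
      ∀ K₁ ∈ Es, ∀ K₂ ∈ Es, y ∈ K₁.support → y ∈ K₂.support → lab K₁ = lab K₂ → K₁ = K₂ := by
  classical
  obtain ⟨d, z, hz, ι, hιinj, hι⟩ := exists_isRsopPart_labels_of_hasSNC hEs y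
  refine ⟨d, z, fun K => if h : K ∈ Es ∧ y ∈ K.support then ι ⟨K, h⟩ else ι ⟨K₀, hK₀, hy₀⟩, hz,
    fun K hK hyK => ?_, fun K₁ h₁ K₂ h₂ hy₁ hy₂ heq => ?_⟩
  · simp only [dif_pos (And.intro hK hyK)]
    exact hι ⟨K, hK, hyK⟩
  · simp only [dif_pos (And.intro h₁ hy₁), dif_pos (And.intro h₂ hy₂)] at heq
    exact congrArg (fun D : {D : X.IdealSheafData // D ∈ Es ∧ y ∈ D.support} => D.1) (hιinj heq)

/-- **The stalk of a monomial ideal as ONE monomial in the labelled parameters**: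
`𝓜(E)_y = (∏_{(K,a) ∈ E, y ∈ V(K)} z(lab K)^a)`. [cite: BierstoneGrigorievMilmanWlodarczyk2011, §4 Step 2b] -/
theorem stalkIdeal_monomialIdeal_eq_span_prod {y : X} {d : ℕ} {z : Fin d → X.presheaf.stalk y}
    {lab : X.IdealSheafData → Fin d} (hlab : ∀ K ∈ Es, y ∈ K.support → stalkIdeal K y = Ideal.span {z (lab K)})
    (E : List (X.IdealSheafData × ℕ)) (hE : ∀ p ∈ E, p.1 ∈ Es) [DecidablePred fun K : X.IdealSheafData => y ∈ K.support] :
    stalkIdeal (monomialIdeal E) y =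
      Ideal.span {(E.map fun p => if y ∈ p.1.support then z (lab p.1) ^ p.2 else 1).prod} := by
  induction E with
  | nil => rw [monomialIdeal_nil, stalkIdeal_top, List.map_nil, List.prod_nil, Ideal.span_singleton_one]
  | cons p E ih =>
    rw [monomialIdeal_cons, stalkIdeal_mul, stalkIdeal_pow, ih fun q hq => hE q (List.mem_cons_of_mem _ hq),
      List.map_cons, List.prod_cons, ← Ideal.span_singleton_mul_span_singleton]
    congr 1
    by_cases hyp : y ∈ p.1.support
    · rw [if_pos hyp, hlab p.1 (hE p List.mem_cons_self) hyp, Ideal.span_singleton_pow]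
    · rw [if_neg hyp, stalkIdeal_eq_top_of_not_mem_support hyp, Ideal.span_singleton_one, Ideal.top_pow]

end Labels

/-! ### §QuasiRegular — a part of a regular system of parameters is quasi-regular -/

section QuasiRegular

/-- **A part of a regular system of parameters is a quasi-regular sequence** (Matsumura Thm. 16.2 (i) for the full system,
Literature's `isQuasiRegular_rsop_comp`; restated here because the packaged form lives in a heavy chart-algebra module).
[cite: Matsumura1987, Thm. 16.2 (i)] -/
theorem IsRsopPart.isQuasiRegular' {R : Type*} [CommRing R] [IsLocalRing R] {n : ℕ} {z : Fin n → R}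
    (hz : IsRsopPart z) : IsQuasiRegular z := by
  haveI := hz.isRegularLocalRing
  obtain ⟨e, x, hd, hx, hxz⟩ := hz.exists_rsop
  have h := isQuasiRegular_rsop_comp hd x hx (Fin.castAdd e) (Fin.castAdd_injective n e)
  have heq : x ∘ Fin.castAdd e = z := funext fun i => hxz i
  rwa [heq] at h

end QuasiRegular

/-! ### §Units — a unit sum in a local ring has a unit summand; dehomogenising a variable -/

section Units

/-- in a local ring, a finite sum which is a unit has a unit summand. [folklore] -/
theorem exists_isUnit_of_isUnit_sum {R : Type*} [CommRing R] [IsLocalRing R] {ι : Type*} (s : Finset ι) (f : ι → R)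
    (h : IsUnit (∑ i ∈ s, f i)) : ∃ i ∈ s, IsUnit (f i) := by
  classical
  induction s using Finset.induction_on with
  | empty => exact absurd h (by rw [Finset.sum_empty]; exact not_isUnit_zero)
  | insert a s ha ih =>
    rw [Finset.sum_insert ha] at h
    rcases IsLocalRing.isUnit_or_isUnit_of_isUnit_add h with h1 | h2
    · exact ⟨a, Finset.mem_insert_self a s, h1⟩
    · obtain ⟨i, hi, hu⟩ := ih h2
      exact ⟨i, Finset.mem_insert_of_mem hi, hu⟩

/-- in a local ring, an exponent vector `b` with `b lH = 0` whose degree is a unit has a unit entry `b l`, `l ≠ lH` (for the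
residue characteristic `p`: `p ∤ deg b ⇒ p ∤ b l` for some `l`). [folklore] -/
theorem exists_ne_isUnit_natCast_of_isUnit_degree {R : Type*} [CommRing R] [IsLocalRing R] {k : ℕ} (b : Fin k →₀ ℕ)
    {lH : Fin k} (hblH : b lH = 0) (h : IsUnit ((b.degree : ℕ) : R)) : ∃ l, l ≠ lH ∧ IsUnit ((b l : ℕ) : R) := by
  rw [Finsupp.degree_eq_sum, Nat.cast_sum] at h
  obtain ⟨l, -, hl⟩ := exists_isUnit_of_isUnit_sum _ _ h
  refine ⟨l, ?_, hl⟩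
  rintro rfl
  rw [hblH, Nat.cast_zero] at hl
  exact not_isUnit_zero hl

/-- dehomogenising a variable. [folklore] -/
theorem dehomogenize_X {A : Type*} [CommRing A] {σ : Type*} [DecidableEq σ] (i s : σ) :
    dehomogenize i (MvPolynomial.X s : MvPolynomial σ A) = killVar i s :=
  MvPolynomial.aeval_X _ _

end Units

end Summit.ResolutionOfSingularities.ResolutionOfSingularities.Theorems.DeltaCutClasses
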